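import Summits.QuantumFields.BalabanUV.T4Continuum.Support.DirichletDecoupledComponents

/-!
# `BalabanUV.T4Continuum.Support.DirichletDecoupledScattered` — NE2 (node U1a) formalisation swarm, SUPPLIER item «Δ1-DECOUPLE» under the
# owner's sub-row `T4-U1a.S-NE2-D1-DIRICHLET°` (wall `hinj`), module (5): SCATTERED SETS OF UNIT BLOCKS — no two blocks share a face
# (they may touch along edges and at vertices: checkerboard patterns, diagonal chains, isolated blocks) — every face-connected component
# is a single block, hence a coordinate box, so road P2's box law `Cbox/N` holds and the Ω-restricted `U = 1` scalar free covariances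
# converge at the FULL rate `L⁻¹`, UNCONDITIONALLY (unit b2b-balaban-t4-ne2-formalise-leaf-08, gen 4, v1)

HONEST FRAMING.  Rung (B)+1 bookkeeping at MODEL level (U = 1 scalar layer `Δ′ = Δ + a′Π′` of [B9] (3.24), King's planting, road P2's
compressed carriers BY NAME), finite torus; a corollary of module (4) (`DirichletDecoupledComponents`) — NOT a new analytic estimate;
NE2 (U1a) is NOT proved by this file; Δ1 NOT closed; spine PROVED 0/9 unchanged; NOT infinite volume, NOT the mass gap, NOT Clay.  HONEST
DEPENDENCY (verbatim): «continuum YM on T⁴ ⇐ BetaPertH ∧ nine spine estimates (0/9 proved); BetaPertH ⇐ (D1) ∧ (D4) ∧ CAP+tail; G-an2-4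
gates asym, D1 and NE2/3/4.»

WHAT THIS FILE PROVES (0 sorry):
 * §1 [shape] **`Scattered M S`** (`∀ b b′ ∈ S, b′ = b + e_μ → b′ = b`: no face-adjacent pair of distinct blocks), `not_adj_of_scattered`
   (the induced face graph has no edge), `eq_of_reachable_of_scattered` (walk induction), **`compOf_iff_eq_of_scattered`** (the component of
   `b₀` is `{b₀}`), `isCoordBox_of_iff_eq`, **`isCoordBox_compOf_of_scattered`** (every component is a coordinate box);
 * §2 **`injected_le_of_scattered (h : Scattered M S) (hN : 1 ≤ N) (ha′) : ‖(D′^{Ω′})⁻¹J^Ω − J^Ω(D^Ω)⁻¹‖ ≤ Cbox d R a′/N`** and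
   **`towerLimitRate_dirichletScalar_scattered (hL : 2 ≤ L) (hd) (ha′) (h : Scattered M S)`** at the FULL rate `L⁻¹` — displayed binders
   `Scattered M S`, `2 ≤ L` ∕ `1 ≤ N`, `0 < d`, `0 < a′`; nothing else.
So the non-monotone VERTEX∕EDGE-contact configurations of Δ1's scalar layer are settled at the box rate whenever no face is shared; the
located residue stays the FACE-CONNECTED non-monotone configurations.

ABSOLUTE RULE (cell, verbatim): «No internally-minted statement may enter as a cited fact. Every hypothesis is either kernel-proved in
this package or a verbatim quotation of a PUBLISHED theorem with page reference. The manuscript(s) under audit are NOT citable for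
their own disputed steps — they are the thing under adjudication; programme-internal (2001/route/tribunal) claims are never citable.»
[folklore]; no `def … : Prop` fact (`Scattered` is a shape predicate with parameters); nothing printed is a hypothesis.  NOT CLAIMED:
face-connected non-monotone unions; the VECTOR layer; [B9] (3.23)–(3.27) as printed; NE2; NE3; «not in print; our proof».
-/

noncomputable section

open scoped BigOperators ComplexConjugate Matrix Matrix.Norms.L2Operator
open Finset Filter Topology

namespace Summit.QuantumFields.BalabanUV.T4Continuum.DirichletDecoupledScattered

open Literature.MathematicalPhysics.QuantumFieldTheory.Balaban1983to89.B5Prop11Plancherel (Tor fine unitVec)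
open Literature.MathematicalPhysics.QuantumFieldTheory.Balaban1983to89.B5G183RateUnitTower (lev lev_neZero)
open Summit.QuantumFields.BalabanUV.T4Continuum
open Summit.QuantumFields.BalabanUV.T4Continuum.CovariantAveragingTower (TowerLimitRate)
open Summit.QuantumFields.BalabanUV.T4Continuum.BackgroundResolventTower
open Summit.QuantumFields.BalabanUV.T4Continuum.ScalarAveragedPropagator (gammaPs)
open Summit.QuantumFields.BalabanUV.T4Continuum.DirichletScalarTower (DsR QsR JsR)
open Summit.QuantumFields.BalabanUV.T4Continuum.DirichletDecoupledComponents (faceGraph faceGraph_adj faceGraphOn faceGraphOn_adj compOf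
  injected_le_of_components_box towerLimitRate_dirichletScalar_components_box)
open Summit.QuantumFields.BalabanUV.Beta.GAN24.DirichletBoxTrace (blockReg)
open Summit.QuantumFields.BalabanUV.Beta.GAN24.DirichletBoxCompression (DOm JOm refineR)
open Summit.QuantumFields.BalabanUV.Beta.GAN24.DirichletBoxTwoLevel (IsCoordBox Cbox)

variable {d : ℕ} (M : Fin d → ℕ) [hM : ∀ μ, NeZero (M μ)]

/-! ## §1 Scattered block sets: every face-connected component is a single block -/

/-- [shape] a SCATTERED set of unit blocks: no block of `S` is a unit translate of a DIFFERENT block of `S` (no face-adjacent pair inside `S`;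
e.g. every other block of a checkerboard, isolated blocks at any mutual position that is not a shared face). [folklore] -/
def Scattered (S : Tor M → Prop) : Prop := ∀ b b', S b → S b' → ∀ μ, b' = b + unitVec M μ → b' = b

variable {M} {S : Tor M → Prop}

omit hM in
/-- in a scattered set the induced face graph has NO edge. [folklore] -/
theorem not_adj_of_scattered (h : Scattered M S) (u v : {b // S b}) : ¬ (faceGraphOn M S).Adj u v := by
  rw [faceGraphOn_adj, faceGraph_adj]
  rintro ⟨hne, μ, hμ | hμ⟩
  · exact hne (h u v u.2 v.2 μ hμ).symm
  · exact hne (h v u v.2 u.2 μ hμ)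

omit hM in
/-- hence reachability in it is equality. [folklore] -/
theorem eq_of_reachable_of_scattered (h : Scattered M S) {u v : {b // S b}} (huv : (faceGraphOn M S).Reachable u v) : u = v := by
  obtain ⟨p⟩ := huv
  cases p with
  | nil => rfl
  | cons hadj _ => exact absurd hadj (not_adj_of_scattered h _ _)

omit hM in
/-- **the face-connected component of a block of a scattered set is that single block**. [folklore] -/
theorem compOf_iff_eq_of_scattered (h : Scattered M S) {b₀ : Tor M} (hb₀ : S b₀) (b : Tor M) :
    compOf M S ((faceGraphOn M S).connectedComponentMk ⟨b₀, hb₀⟩) b ↔ b = b₀ := by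
  constructor
  · rintro ⟨hb, hc⟩
    exact congrArg Subtype.val (eq_of_reachable_of_scattered h (SimpleGraph.ConnectedComponent.exact hc))
  · rintro rfl
    exact ⟨hb₀, rfl⟩

omit hM in
/-- a block set that is (pointwise) a single block is a coordinate box. [folklore] -/
theorem isCoordBox_of_iff_eq {T : Tor M → Prop} {b₀ : Tor M} (hT : ∀ b, T b ↔ b = b₀) : IsCoordBox M T :=
  ⟨fun μ => {b₀ μ}, fun b => by rw [hT b]; simp only [Finset.mem_singleton]; exact funext_iff⟩

omit hM in
/-- **every face-connected component of a scattered set is a coordinate box** (a single block). [folklore] -/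
theorem isCoordBox_compOf_of_scattered (h : Scattered M S) (c : (faceGraphOn M S).ConnectedComponent) : IsCoordBox M (compOf M S c) := by
  induction c using SimpleGraph.ConnectedComponent.ind with
  | h v => exact isCoordBox_of_iff_eq (compOf_iff_eq_of_scattered h v.2)

/-! ## §2 The ENDs: scattered sets obey the box law and converge at the full rate -/

section Ends

variable (N R : ℕ) [NeZero N] [NeZero R] (a' : ℝ) [DecidablePred S]

/-- **ROAD P2's BOX LAW ON EVERY SCATTERED SET OF UNIT BLOCKS**: `‖(D′^{Ω′})⁻¹J^Ω − J^Ω(D^Ω)⁻¹‖ ≤ Cbox d R a′/N` for `Ω = blockReg N M S`,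
`S` scattered — displayed binders `Scattered M S`, `1 ≤ N`, `0 < a′`; nothing else. [folklore] -/
theorem injected_le_of_scattered (h : Scattered M S) (hN : 1 ≤ N) (ha' : 0 < a') :
    ‖(DOm (R * N) M a' (refineR N R M (blockReg N M S)))⁻¹ * JOm N R M (blockReg N M S)
        - JOm N R M (blockReg N M S) * (DOm N M a' (blockReg N M S))⁻¹‖ ≤ Cbox d R a' / N :=
  injected_le_of_components_box S N R a' (isCoordBox_compOf_of_scattered h) hN ha'

end Ends

section Tower

variable (L : ℕ) [NeZero L] (a' : ℝ) [DecidablePred S]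

/-- **THE Ω-RESTRICTED UNIT-LATTICE SCALAR FREE COVARIANCES OF EVERY SCATTERED SET OF UNIT BLOCKS CONVERGE AT THE FULL RATE `L⁻¹`**
(`L ≥ 2`, `d ≥ 1`, `a′ > 0`), UNCONDITIONALLY — e.g. every other block of a checkerboard, however many blocks, touching at vertices and
edges but never across a face. [folklore] -/
theorem towerLimitRate_dirichletScalar_scattered (hL : 2 ≤ L) (hd : 0 < d) (ha' : 0 < a') (h : Scattered M S) :
    TowerLimitRate (QsR L M (blockReg (lev L 0) M S)) ((L : ℝ) ^ d) (fun k => (DsR L M a' (blockReg (lev L 0) M S) k)⁻¹)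
      (Cpert 0 (2 * d * Real.sqrt ((gammaPs d a')⁻¹)) (Cbox d L a') 0 0 0) ((L : ℝ)⁻¹) :=
  towerLimitRate_dirichletScalar_components_box S L a' hL hd ha' (isCoordBox_compOf_of_scattered h)

end Tower

end Summit.QuantumFields.BalabanUV.T4Continuum.DirichletDecoupledScattered

end
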